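import Literature.Algebra.Polynomial.CasasAlvero.Degree8CharP
import HarnessLib

/-!
# Casas-Alvero in degree 8 fails in characteristic 17, 19

Explicit prime-field-rational Casas-Alvero polynomials of degree 8 in the depressed normal form
`X^8 + c_6 X^6 + ... + c_1 X` with prime-field witnesses, found by the exhaustive normal-form search `dgen/search_par.py`
of the seat-2 g4 packet (all `f` of this shape over `F_p` whose Hasse derivatives `H_1 f, …, H_7 f` each vanish at an
`F_p`-rational root of `f`).  Each refutes `CA_8` over EVERY field of that characteristic.  [folklore]
-/

noncomputable section

open Polynomial

namespace Literature.Algebra.Polynomial.CasasAlvero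

variable (K : Type*) [Field K]

section Char17
variable [CharP K 17]

/-- `X^8 + (-5) X^6 + (-4) X^4 + (-1) X^1` is Casas-Alvero in characteristic 17 (witness roots H1↦-6, H2↦0, H3↦0, H4↦5, H5↦0, H6↦-6, H7↦0). [folklore] -/
theorem isCasasAlvero_nf8_char_17 : IsCasasAlvero (nf8 K (-5) (0) (-4) (0) (0) (-1)) := by
  have hp : (17 : K) = 0 := by simpa using CharP.cast_eq_zero K 17
  intro i hi0 hi
  rw [natDegree_nf8] at hi
  unfold nf8
  interval_cases i
  · refine ⟨(-6 : K), ?_, ?_⟩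
    · simp only [eval_add, eval_pow, eval_X, eval_smul, smul_eq_mul]
      linear_combination (84774 : K) * hp
    · simp only [map_add, map_smul, hasseDeriv_X_pow, eval_add, eval_mul, eval_C, eval_pow, eval_X, eval_smul, smul_eq_mul,
        show Nat.choose 8 1 = 8 from rfl, show Nat.choose 6 1 = 6 from rfl, show Nat.choose 5 1 = 5 from rfl, show Nat.choose 4 1 = 4 from rfl, show Nat.choose 3 1 = 3 from rfl, show Nat.choose 2 1 = 2 from rfl, show Nat.choose 1 1 = 1 from rfl]
      push_cast
      linear_combination (-117809 : K) * hp
  · refine ⟨(0 : K), ?_, ?_⟩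
    · simp only [eval_add, eval_pow, eval_X, eval_smul, smul_eq_mul]
      linear_combination (0 : K) * hp
    · simp only [map_add, map_smul, hasseDeriv_X_pow, eval_add, eval_mul, eval_C, eval_pow, eval_X, eval_smul, smul_eq_mul,
        show Nat.choose 8 2 = 28 from rfl, show Nat.choose 6 2 = 15 from rfl, show Nat.choose 5 2 = 10 from rfl, show Nat.choose 4 2 = 6 from rfl, show Nat.choose 3 2 = 3 from rfl, show Nat.choose 2 2 = 1 from rfl, show Nat.choose 1 2 = 0 from rfl]
      push_cast
      linear_combination (0 : K) * hp
  · refine ⟨(0 : K), ?_, ?_⟩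
    · simp only [eval_add, eval_pow, eval_X, eval_smul, smul_eq_mul]
      linear_combination (0 : K) * hp
    · simp only [map_add, map_smul, hasseDeriv_X_pow, eval_add, eval_mul, eval_C, eval_pow, eval_X, eval_smul, smul_eq_mul,
        show Nat.choose 8 3 = 56 from rfl, show Nat.choose 6 3 = 20 from rfl, show Nat.choose 5 3 = 10 from rfl, show Nat.choose 4 3 = 4 from rfl, show Nat.choose 3 3 = 1 from rfl, show Nat.choose 2 3 = 0 from rfl, show Nat.choose 1 3 = 0 from rfl]
      push_cast
      linear_combination (0 : K) * hp
  · refine ⟨(5 : K), ?_, ?_⟩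
    · simp only [eval_add, eval_pow, eval_X, eval_smul, smul_eq_mul]
      linear_combination (18235 : K) * hp
    · simp only [map_add, map_smul, hasseDeriv_X_pow, eval_add, eval_mul, eval_C, eval_pow, eval_X, eval_smul, smul_eq_mul,
        show Nat.choose 8 4 = 70 from rfl, show Nat.choose 6 4 = 15 from rfl, show Nat.choose 5 4 = 5 from rfl, show Nat.choose 4 4 = 1 from rfl, show Nat.choose 3 4 = 0 from rfl, show Nat.choose 2 4 = 0 from rfl, show Nat.choose 1 4 = 0 from rfl]
      push_cast
      linear_combination (2463 : K) * hp
  · refine ⟨(0 : K), ?_, ?_⟩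
    · simp only [eval_add, eval_pow, eval_X, eval_smul, smul_eq_mul]
      linear_combination (0 : K) * hp
    · simp only [map_add, map_smul, hasseDeriv_X_pow, eval_add, eval_mul, eval_C, eval_pow, eval_X, eval_smul, smul_eq_mul,
        show Nat.choose 8 5 = 56 from rfl, show Nat.choose 6 5 = 6 from rfl, show Nat.choose 5 5 = 1 from rfl, show Nat.choose 4 5 = 0 from rfl, show Nat.choose 3 5 = 0 from rfl, show Nat.choose 2 5 = 0 from rfl, show Nat.choose 1 5 = 0 from rfl]
      push_cast
      linear_combination (0 : K) * hp
  · refine ⟨(-6 : K), ?_, ?_⟩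
    · simp only [eval_add, eval_pow, eval_X, eval_smul, smul_eq_mul]
      linear_combination (84774 : K) * hp
    · simp only [map_add, map_smul, hasseDeriv_X_pow, eval_add, eval_mul, eval_C, eval_pow, eval_X, eval_smul, smul_eq_mul,
        show Nat.choose 8 6 = 28 from rfl, show Nat.choose 6 6 = 1 from rfl, show Nat.choose 5 6 = 0 from rfl, show Nat.choose 4 6 = 0 from rfl, show Nat.choose 3 6 = 0 from rfl, show Nat.choose 2 6 = 0 from rfl, show Nat.choose 1 6 = 0 from rfl]
      push_cast
      linear_combination (59 : K) * hp
  · refine ⟨(0 : K), ?_, ?_⟩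
    · simp only [eval_add, eval_pow, eval_X, eval_smul, smul_eq_mul]
      linear_combination (0 : K) * hp
    · simp only [map_add, map_smul, hasseDeriv_X_pow, eval_add, eval_mul, eval_C, eval_pow, eval_X, eval_smul, smul_eq_mul,
        show Nat.choose 8 7 = 8 from rfl, show Nat.choose 6 7 = 0 from rfl, show Nat.choose 5 7 = 0 from rfl, show Nat.choose 4 7 = 0 from rfl, show Nat.choose 3 7 = 0 from rfl, show Nat.choose 2 7 = 0 from rfl, show Nat.choose 1 7 = 0 from rfl]
      push_cast
      linear_combination (0 : K) * hp

end Char17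

section Char19
variable [CharP K 19]

/-- `X^8 + (-4) X^6 + (-1) X^1` is Casas-Alvero in characteristic 19 (witness roots H1↦7, H2↦0, H3↦0, H4↦0, H5↦0, H6↦7, H7↦0). [folklore] -/
theorem isCasasAlvero_nf8_char_19 : IsCasasAlvero (nf8 K (-4) (0) (0) (0) (0) (-1)) := by
  have hp : (19 : K) = 0 := by simpa using CharP.cast_eq_zero K 19
  intro i hi0 hi
  rw [natDegree_nf8] at hi
  unfold nf8
  interval_cases i
  · refine ⟨(7 : K), ?_, ?_⟩
    · simp only [eval_add, eval_pow, eval_X, eval_smul, smul_eq_mul]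
      linear_combination (278642 : K) * hp
    · simp only [map_add, map_smul, hasseDeriv_X_pow, eval_add, eval_mul, eval_C, eval_pow, eval_X, eval_smul, smul_eq_mul,
        show Nat.choose 8 1 = 8 from rfl, show Nat.choose 6 1 = 6 from rfl, show Nat.choose 5 1 = 5 from rfl, show Nat.choose 4 1 = 4 from rfl, show Nat.choose 3 1 = 3 from rfl, show Nat.choose 2 1 = 2 from rfl, show Nat.choose 1 1 = 1 from rfl]
      push_cast
      linear_combination (325525 : K) * hp
  · refine ⟨(0 : K), ?_, ?_⟩
    · simp only [eval_add, eval_pow, eval_X, eval_smul, smul_eq_mul]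
      linear_combination (0 : K) * hp
    · simp only [map_add, map_smul, hasseDeriv_X_pow, eval_add, eval_mul, eval_C, eval_pow, eval_X, eval_smul, smul_eq_mul,
        show Nat.choose 8 2 = 28 from rfl, show Nat.choose 6 2 = 15 from rfl, show Nat.choose 5 2 = 10 from rfl, show Nat.choose 4 2 = 6 from rfl, show Nat.choose 3 2 = 3 from rfl, show Nat.choose 2 2 = 1 from rfl, show Nat.choose 1 2 = 0 from rfl]
      push_cast
      linear_combination (0 : K) * hp
  · refine ⟨(0 : K), ?_, ?_⟩
    · simp only [eval_add, eval_pow, eval_X, eval_smul, smul_eq_mul]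
      linear_combination (0 : K) * hp
    · simp only [map_add, map_smul, hasseDeriv_X_pow, eval_add, eval_mul, eval_C, eval_pow, eval_X, eval_smul, smul_eq_mul,
        show Nat.choose 8 3 = 56 from rfl, show Nat.choose 6 3 = 20 from rfl, show Nat.choose 5 3 = 10 from rfl, show Nat.choose 4 3 = 4 from rfl, show Nat.choose 3 3 = 1 from rfl, show Nat.choose 2 3 = 0 from rfl, show Nat.choose 1 3 = 0 from rfl]
      push_cast
      linear_combination (0 : K) * hp
  · refine ⟨(0 : K), ?_, ?_⟩
    · simp only [eval_add, eval_pow, eval_X, eval_smul, smul_eq_mul]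
      linear_combination (0 : K) * hp
    · simp only [map_add, map_smul, hasseDeriv_X_pow, eval_add, eval_mul, eval_C, eval_pow, eval_X, eval_smul, smul_eq_mul,
        show Nat.choose 8 4 = 70 from rfl, show Nat.choose 6 4 = 15 from rfl, show Nat.choose 5 4 = 5 from rfl, show Nat.choose 4 4 = 1 from rfl, show Nat.choose 3 4 = 0 from rfl, show Nat.choose 2 4 = 0 from rfl, show Nat.choose 1 4 = 0 from rfl]
      push_cast
      linear_combination (0 : K) * hp
  · refine ⟨(0 : K), ?_, ?_⟩
    · simp only [eval_add, eval_pow, eval_X, eval_smul, smul_eq_mul]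
      linear_combination (0 : K) * hp
    · simp only [map_add, map_smul, hasseDeriv_X_pow, eval_add, eval_mul, eval_C, eval_pow, eval_X, eval_smul, smul_eq_mul,
        show Nat.choose 8 5 = 56 from rfl, show Nat.choose 6 5 = 6 from rfl, show Nat.choose 5 5 = 1 from rfl, show Nat.choose 4 5 = 0 from rfl, show Nat.choose 3 5 = 0 from rfl, show Nat.choose 2 5 = 0 from rfl, show Nat.choose 1 5 = 0 from rfl]
      push_cast
      linear_combination (0 : K) * hp
  · refine ⟨(7 : K), ?_, ?_⟩
    · simp only [eval_add, eval_pow, eval_X, eval_smul, smul_eq_mul]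
      linear_combination (278642 : K) * hp
    · simp only [map_add, map_smul, hasseDeriv_X_pow, eval_add, eval_mul, eval_C, eval_pow, eval_X, eval_smul, smul_eq_mul,
        show Nat.choose 8 6 = 28 from rfl, show Nat.choose 6 6 = 1 from rfl, show Nat.choose 5 6 = 0 from rfl, show Nat.choose 4 6 = 0 from rfl, show Nat.choose 3 6 = 0 from rfl, show Nat.choose 2 6 = 0 from rfl, show Nat.choose 1 6 = 0 from rfl]
      push_cast
      linear_combination (72 : K) * hp
  · refine ⟨(0 : K), ?_, ?_⟩
    · simp only [eval_add, eval_pow, eval_X, eval_smul, smul_eq_mul]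
      linear_combination (0 : K) * hp
    · simp only [map_add, map_smul, hasseDeriv_X_pow, eval_add, eval_mul, eval_C, eval_pow, eval_X, eval_smul, smul_eq_mul,
        show Nat.choose 8 7 = 8 from rfl, show Nat.choose 6 7 = 0 from rfl, show Nat.choose 5 7 = 0 from rfl, show Nat.choose 4 7 = 0 from rfl, show Nat.choose 3 7 = 0 from rfl, show Nat.choose 2 7 = 0 from rfl, show Nat.choose 1 7 = 0 from rfl]
      push_cast
      linear_combination (0 : K) * hp

end Char19

/-- `CA_8` FAILS over every field of characteristic `17`. [folklore] -/
theorem not_holdsInDegree_eight_of_char_17 [CharP K 17] : ¬ HoldsInDegree K 8 := by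
  have hq : (17 : K) = 0 := by simpa using CharP.cast_eq_zero K 17
  exact not_holdsInDegree_eight_of_nf8 K (isCasasAlvero_nf8_char_17 K)
    (fun h => one_ne_zero (by linear_combination (5 : K) * h - (-3 : K) * hq : (1 : K) = 0))

/-- `CA_8` FAILS over every field of characteristic `19`. [folklore] -/
theorem not_holdsInDegree_eight_of_char_19 [CharP K 19] : ¬ HoldsInDegree K 8 := by
  have hq : (19 : K) = 0 := by simpa using CharP.cast_eq_zero K 19
  exact not_holdsInDegree_eight_of_nf8 K (isCasasAlvero_nf8_char_19 K)
    (fun h => one_ne_zero (by linear_combination (-4 : K) * h - (1 : K) * hq : (1 : K) = 0))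

end Literature.Algebra.Polynomial.CasasAlvero
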